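import Summits.FinalStateConjecture.FinalStateConjecture.Theorems.ClusterCompletenessAdiabaticMultiKerrILEDField
import Summits.FinalStateConjecture.FinalStateConjecture.Theorems.ClusterCompletenessAdiabaticMultiKerrILEDFiniteTimeAux
import Summits.FinalStateConjecture.FinalStateConjecture.Theorems.ClusterCompletenessAdiabaticMultiKerrILEDCruxFieldPointwise
import Summits.FinalStateConjecture.FinalStateConjecture.Theorems.ClusterCompletenessAdiabaticMultiKerrILEDSlabWeight
import Summits.FinalStateConjecture.FinalStateConjecture.Theorems.ClusterCompletenessAdiabaticMultiKerrILEDSlabGronwall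
import Literature.Geometry.Lorentzian.KerrDomainOfDependence
import Literature.Geometry.Lorentzian.KerrSchildLocalEnergy

/-!
# Route ClusterCompleteness — crux `AdiabaticMultiKerrILED`, line `Sketch`: finite-time energy growth

Helper file for the crux `stmt-FinalStateConjecture-14310`, closing the stub `stub_finiteTimeEnergy`
of line `Sketch` (the lead's assembly): from the pointwise structure of the patched field at slab points
(`stub_cruxFieldPointwise`), the weight and its signed flux (`stub_slabWeight`) and the slab Grönwall
inequality (`stub_slabGronwall`) — all landed — the lab-frame exterior energy of every smooth
solution satisfies `E[ψ](t) ≤ K e^{Kt} E[ψ](0)` (`t ≥ 0`). Auxiliary lemmas (`fte_*`) live in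
`…FiniteTimeAux.lean`. Hawking–Ellis 1973, §4.3, Lemma 4.3.1 (weighted form). [folklore]
-/

noncomputable section

-- the doubled `FinalStateConjecture.FinalStateConjecture` path component trips dupNamespace
set_option linter.dupNamespace false

open scoped ContDiff Topology InnerProductSpace BigOperators ENNReal
open MeasureTheory Metric Set Filter Literature.Geometry.Lorentzian

namespace Summit.FinalStateConjecture.FinalStateConjecture.Cruxes.AdiabaticMultiKerrILED.Sketch

/-- **Finite-time energy growth** (from the landed field-at-slab-points, weight-and-flux and
slab-Grönwall stubs): the lab-frame exterior energy satisfies `E[ψ](t) ≤ K e^{Kt} E[ψ](0)` for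
`t ≥ 0` — choose `T = t`, `A = t + R + 1`, `εᵢ = (θ/2) e^{−Bᵢ/(2Mᵢ)}` (`Bᵢ` a bound for the
rest-frame time on the slab ball, so that the layers stay in `{rᵢ ≤ r₊ᵢ + θ} ⊆ {rᵢ ≤ 8Mᵢ}`),
compare `∑(∂ψ)² ≤ 6 T^{00} ≤ 18(1+Φ)² ∑(∂ψ)²` at the constant background of each point, and
remove `θ → 0`, `R → ∞` by monotone convergence. Hawking–Ellis 1973, §4.3, Lemma 4.3.1 (weighted
form). [folklore] -/
theorem stub_finiteTimeEnergy :
    ∀ (N : ℕ) (M a : Fin N → ℝ) (Λ : Fin N → lorentzGroup) (p : Fin N → E3) (u : Fin N → E4)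
      (q : Fin N → E4 → E4),
      (∀ i, u i = (Λ i : E4 ≃L[ℝ] E4) (E4.basisVector 0)) →
      (∀ i x, q i x = poincareInv (Λ i) (E4.ofTimeSpace 0 (p i)) x) →
      (∀ i, 0 < M i) → (∀ i, |a i| ≤ 2⁻¹ * M i) →
      (∀ i, 0 < u i 0 ∧ ‖E4.spatial (u i)‖ ≤ 2⁻¹ * u i 0) →
      (∀ i j, i ≠ j → 40 * (M i + M j) ≤ dist (p i) (p j) ∧
        0 < ⟪p i - p j, (u i 0)⁻¹ • E4.spatial (u i) - (u j 0)⁻¹ • E4.spatial (u j)⟫_ℝ) →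
      ∀ (G : E4 → Fin 4 → Fin 4 → ℝ),
      (∀ x μ ν, G x μ ν = Minkowski.bilin (E4.basisVector μ) (E4.basisVector ν) -
        ∑ i, Real.smoothTransition (2 - Kerr.radius (a i) (q i x) / (8 * M i)) *
          (2 * Kerr.scalarH (M i) (a i) (q i x)) *
          ((Λ i : E4 ≃L[ℝ] E4) (Kerr.nullVector (a i) (q i x))) μ *
          ((Λ i : E4 ≃L[ℝ] E4) (Kerr.nullVector (a i) (q i x))) ν) →
      ∀ (E : (E4 → ℝ) → ℝ → ENNReal),
      (∀ φ t, E φ t = ∫⁻ y in {y : E3 | ∀ i, Kerr.rPlus (M i) (a i) <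
          Kerr.radius (a i) (q i (E4.ofTimeSpace t y))},
        ENNReal.ofReal (∑ μ : Fin 4, (fderiv ℝ φ (E4.ofTimeSpace t y) (E4.basisVector μ)) ^ 2)) →
      ∃ K : ℝ, 0 ≤ K ∧ ∀ ψ : E4 → ℝ, ContDiff ℝ ∞ ψ →
        (∀ x : E4, 0 ≤ x 0 → (∀ i, Kerr.rPlus (M i) (a i) < Kerr.radius (a i) (q i x)) →
          ∑ μ : Fin 4, fderiv ℝ (fun y ↦ ∑ ν : Fin 4, G y μ ν * fderiv ℝ ψ y (E4.basisVector ν)) x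
            (E4.basisVector μ) = 0) →
        ∀ t : ℝ, 0 ≤ t → E ψ t ≤ ENNReal.ofReal (K * Real.exp (K * t)) * E ψ 0 := by
  intro N M a Λ p u q hu hq hM ha hv hsep G hG E hE
  obtain ⟨Φ, D, hΦ0, hD0, hKS, hDb, hlayer⟩ := stub_cruxFieldPointwise M a Λ p u q hu hq hM ha hv hsep G hG
  refine ⟨18 * (1 + Φ) ^ 2 + 192 * (1 + Φ) * D + 1, by positivity, fun ψ hψ hsol t ht ↦ ?_⟩
  by_cases htop : E ψ 0 = ⊤
  · have hpos : 0 < (18 * (1 + Φ) ^ 2 + 192 * (1 + Φ) * D + 1) *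
        Real.exp ((18 * (1 + Φ) ^ 2 + 192 * (1 + Φ) * D + 1) * t) := by positivity
    rw [htop, ENNReal.mul_top (ENNReal.ofReal_pos.mpr hpos).ne']
    exact le_top
  have h0c : Continuous fun x : E4 ↦ x 0 := (contDiff_apply_zero (n := 0)).continuous
  have hqcont : ∀ i, Continuous (q i) := fun i ↦ by
    have : q i = poincareInv (Λ i) (E4.ofTimeSpace 0 (p i)) := funext (hq i)
    rw [this]; exact continuous_poincareInv _ _
  have hrcont : ∀ i, Continuous fun x : E4 ↦ Kerr.radius (a i) (q i x) := fun i ↦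
    (Kerr.continuous_radius (a i)).comp (hqcont i)
  have hhcont : ∀ i, Continuous fun x : E4 ↦ Kerr.horizonFn (M i) (a i) (q i x) := fun i ↦ by
    unfold Kerr.horizonFn
    exact ((hrcont i).sub continuous_const).mul
      (Real.continuous_exp.comp (continuous_const.mul (h0c.comp (hqcont i))).neg)
  have hgcont : ∀ s, Continuous fun y : E3 ↦
      ∑ μ : Fin 4, (fderiv ℝ ψ (E4.ofTimeSpace s y) (E4.basisVector μ)) ^ 2 := fun s ↦ by
    refine continuous_finsetSum _ fun μ _ ↦ ?_
    exact (((hψ.continuous_fderiv (by simp)).comp (E4.continuous_ofTimeSpace s)).clm_apply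
      continuous_const).pow 2
  have hgnn : ∀ s y, 0 ≤ ∑ μ : Fin 4, (fderiv ℝ ψ (E4.ofTimeSpace s y) (E4.basisVector μ)) ^ 2 :=
    fun s y ↦ Finset.sum_nonneg fun _ _ ↦ sq_nonneg _
  -- the truncated estimate
  have key : ∀ (θ R : ℝ), 0 < θ → (∀ i, θ ≤ 6 * M i) → 0 < R →
      ∫⁻ y in {y : E3 | ‖y‖ ≤ R ∧ ∀ i, Kerr.rPlus (M i) (a i) + θ ≤
          Kerr.radius (a i) (q i (E4.ofTimeSpace t y))},
        ENNReal.ofReal (∑ μ : Fin 4, (fderiv ℝ ψ (E4.ofTimeSpace t y) (E4.basisVector μ)) ^ 2) ≤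
        ENNReal.ofReal (18 * (1 + Φ) ^ 2 * Real.exp (192 * (1 + Φ) * D * t)) * E ψ 0 := by
    intro θ R hθ hθM hR
    have hTA : t < t + R + 1 := by linarith
    set B : Fin N → ℝ := fun i ↦
      ‖((Λ i : E4 ≃L[ℝ] E4).symm : E4 →L[ℝ] E4)‖ * (t + (t + R + 1 + 2) + ‖p i‖) with hB
    set ε : Fin N → ℝ := fun i ↦ θ / 2 * Real.exp (-((2 * M i)⁻¹ * B i)) with hε
    have hεpos : ∀ i, 0 < ε i := fun i ↦ by positivity
    have h2ε : ∀ i, 2 * ε i = θ * Real.exp (-((2 * M i)⁻¹ * B i)) := fun i ↦ by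
      simp only [hε]; ring
    have hexp : ∀ i (x : E4), 0 ≤ x 0 → x 0 ≤ t → E4.spatialNorm x ≤ t + R + 1 + 2 →
        Real.exp (-((2 * M i)⁻¹ * B i)) ≤ Real.exp (-((2 * M i)⁻¹ * (q i x) 0)) := by
      intro i x hx0 hxT hxρ
      rw [hq i x]
      exact fte_exp_restTime_le (Λ i) (p i) (hM i) hx0 hxT hxρ
    set W : E4 → ℝ := fun x ↦ Kerr.timeSlabCutoff t (t + R + 1) (x 0) *
        Real.smoothTransition (Kerr.coneFn (t + R + 1) 0 x) *
        ∏ i, Real.smoothTransition (Kerr.horizonFn (M i) (a i) (q i x) / ε i - 1) with hWdef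
    obtain ⟨hWC1, hW01, hWsupp, hWone, hWflux⟩ :=
      stub_slabWeight M a Λ p u q hu hq hM ha hv hsep G hG t (t + R + 1) ε hTA hεpos W (fun x ↦ rfl)
    set K : Set E4 := {x : E4 | -2 ≤ x 0 ∧ x 0 ≤ t + R + 1 ∧ E4.spatialNorm x ≤ t + R + 1 + 2 ∧
      ∀ i, ε i ≤ Kerr.horizonFn (M i) (a i) (q i x)} with hKdef
    have hKclosed : IsClosed K := fte_isClosed_slabSet hhcont ε (t + R + 1) (t + R + 1 + 2)
    have hextK : ∀ x ∈ K, ∀ i, Kerr.rPlus (M i) (a i) < Kerr.radius (a i) (q i x) := by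
      intro x hx i
      have hpos : 0 < Kerr.horizonFn (M i) (a i) (q i x) := (hεpos i).trans_le (hx.2.2.2 i)
      unfold Kerr.horizonFn at hpos
      have := (mul_pos_iff_of_pos_right (Real.exp_pos _)).mp hpos
      linarith
    have hWK : ∀ x, W x ≠ 0 → x ∈ K := by
      intro x hWx
      obtain ⟨h1, h2, h3, h4⟩ := hWsupp x hWx
      exact ⟨h1.le, h2.le, by linarith, fun i ↦ (h4 i).le⟩
    have hG2K : ∀ x ∈ K, ∀ μ ν, ContDiffAt ℝ 2 (fun y ↦ G y μ ν) x := fun x hx μ ν ↦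
      (Theorems.contDiffAt_cruxField_of_exterior hq hM hG (hextK x hx) μ ν).of_le
        (WithTop.coe_le_coe.mpr le_top)
    have hsolK : ∀ x ∈ K, 0 ≤ x 0 → x 0 ≤ t → KerrSchild.waveOperator G ψ x = 0 := by
      intro x hx hx0 _
      rw [← Theorems.cruxWave_eq_waveOperator]
      exact hsol x hx0 (hextK x hx)
    have hKSK : ∀ x ∈ K, 0 ≤ x 0 → x 0 ≤ t →
        ∃ (φ₀ : ℝ) (l₀ : E4), 0 ≤ φ₀ ∧ φ₀ ≤ Φ ∧
          Minkowski.bilin l₀ l₀ = 0 ∧ Minkowski.bilin l₀ (E4.basisVector 0) = 1 ∧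
          ∀ μ ν, G x μ ν = Kerr.etaComp μ ν - φ₀ * l₀ μ * l₀ ν :=
      fun x hx hx0 _ ↦ hKS x hx0 (hextK x hx)
    have hlayK : ∀ x ∈ K, 0 ≤ x 0 → x 0 ≤ t → ∀ i,
        Kerr.horizonFn (M i) (a i) (q i x) ≤ 2 * ε i → Kerr.radius (a i) (q i x) ≤ 8 * M i := by
      intro x hx hx0 hxT i hh
      have he := hexp i x hx0 hxT hx.2.2.1
      have hr : Kerr.rPlus (M i) (a i) < Kerr.radius (a i) (q i x) := hextK x hx i
      rw [h2ε i] at hh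
      unfold Kerr.horizonFn at hh
      have hsub : Kerr.radius (a i) (q i x) - Kerr.rPlus (M i) (a i) ≤ θ :=
        fte_le_of_mul_exp_le (Real.exp_pos _) he (by linarith) hh
      have h2M : Kerr.rPlus (M i) (a i) ≤ 2 * M i := by
        have hs : Real.sqrt (M i ^ 2 - a i ^ 2) ≤ Real.sqrt (M i ^ 2) :=
          Real.sqrt_le_sqrt (sub_le_self _ (sq_nonneg _))
        rw [Real.sqrt_sq (hM i).le] at hs
        unfold Kerr.rPlus; linarith
      linarith [hθM i]
    have hfluxK : ∀ x ∈ K, 0 ≤ x 0 → x 0 ≤ t →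
        ∑ μ, fderiv ℝ W x (E4.basisVector μ) * KerrSchild.normalCurrent G ψ x μ ≤ 0 := by
      intro x hx hx0 hxT
      obtain ⟨φ₀, l₀, hφ0, -, hnull, hnorm, hGx⟩ := hKS x hx0 (hextK x hx)
      refine hWflux ψ x hx0 hxT (hextK x hx) ⟨φ₀, l₀, hφ0, hnull, hnorm, hGx⟩ ?_
      intro i hh
      exact hlayer x hx0 i (hlayK x hx hx0 hxT i hh)
    have hgron := stub_slabGronwall G W ψ K Φ D t (t + R + 1 + 2) hΦ0 hD0 ht hKclosed (fun x hx ↦ hx.2.2.1) hWC1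
      (fun x ↦ (hW01 x).1) hWK hG2K (fun x _ μ ν ↦ Theorems.cruxField_symm hG x μ ν) hψ hsolK hKSK
      (fun x hx _ _ ↦ hDb x (hextK x hx)) hfluxK t ht le_rfl
    have hJcont : Continuous fun x : E4 ↦ W x * KerrSchild.normalCurrent G ψ x 0 := by
      refine continuous_iff_continuousAt.mpr fun x ↦ ?_
      refine continuousAt_weight_mul hKclosed (subset_refl K) hWC1.continuous
        (fun y hy ↦ ?_) (fun y hy ↦ ?_) x
      · by_contra h
        exact hy (hWK y h)
      · exact (fte_contDiffAt_normalCurrent (fun μ ν ↦ (hG2K y hy μ ν).of_le one_le_two)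
          (hψ.contDiffAt.of_le (WithTop.coe_le_coe.mpr le_top)) 0).continuousAt
    have hJnn : ∀ s, 0 ≤ s → s ≤ t → ∀ y : E3,
        0 ≤ W (E4.ofTimeSpace s y) * KerrSchild.normalCurrent G ψ (E4.ofTimeSpace s y) 0 := by
      intro s hs0 hst y
      by_cases hWy : W (E4.ofTimeSpace s y) = 0
      · rw [hWy, zero_mul]
      · have hyK := hWK _ hWy
        obtain ⟨φ₀, l₀, hφ0, hφΦ, hnull, hnorm, hGx⟩ :=
          hKSK _ hyK (by rw [E4.ofTimeSpace_apply_zero]; exact hs0)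
            (by rw [E4.ofTimeSpace_apply_zero]; exact hst)
        exact mul_nonneg (hW01 _).1 (fte_pointwise ψ hφ0 hφΦ hnull hnorm hGx).1
    set S : Set E3 := {y : E3 | ‖y‖ ≤ R ∧ ∀ i, Kerr.rPlus (M i) (a i) + θ ≤
        Kerr.radius (a i) (q i (E4.ofTimeSpace t y))} with hSdef
    have hSball : S ⊆ closedBall (0 : E3) (t + R + 1 + 2) := fun y hy ↦ by
      rw [mem_closedBall, dist_zero_right]; linarith [hy.1]
    have hSclosed : IsClosed S :=
      fte_isClosed_truncSet (fun i ↦ (hrcont i).comp (E4.continuous_ofTimeSpace t)) _ R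
    have hWS : ∀ y ∈ S, W (E4.ofTimeSpace t y) = 1 := by
      intro y hy
      apply hWone
      · rw [E4.ofTimeSpace_apply_zero]; exact ht
      · rw [E4.ofTimeSpace_apply_zero]
      · simp only [Kerr.coneFn, E4.ofTimeSpace_apply_zero, E4.spatial_ofTimeSpace, sub_zero]
        nlinarith [hy.1, norm_nonneg y]
      · intro i
        have hr := hy.2 i
        have he := hexp i (E4.ofTimeSpace t y) (by rw [E4.ofTimeSpace_apply_zero]; exact ht)
          (by rw [E4.ofTimeSpace_apply_zero]) (by rw [E4.spatialNorm_ofTimeSpace]; linarith [hy.1])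
        rw [h2ε i]
        unfold Kerr.horizonFn
        calc θ * Real.exp (-((2 * M i)⁻¹ * B i))
            ≤ θ * Real.exp (-((2 * M i)⁻¹ * (q i (E4.ofTimeSpace t y)) 0)) :=
              mul_le_mul_of_nonneg_left he hθ.le
          _ ≤ (Kerr.radius (a i) (q i (E4.ofTimeSpace t y)) - Kerr.rPlus (M i) (a i)) *
                Real.exp (-((2 * M i)⁻¹ * (q i (E4.ofTimeSpace t y)) 0)) :=
              mul_le_mul_of_nonneg_right (by linarith) (Real.exp_pos _).le
    have hcoer : ∀ y ∈ S, (∑ μ : Fin 4, (fderiv ℝ ψ (E4.ofTimeSpace t y) (E4.basisVector μ)) ^ 2) ≤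
        6 * (W (E4.ofTimeSpace t y) * KerrSchild.normalCurrent G ψ (E4.ofTimeSpace t y) 0) := by
      intro y hy
      rw [hWS y hy, one_mul]
      have hext' : ∀ i, Kerr.rPlus (M i) (a i) < Kerr.radius (a i) (q i (E4.ofTimeSpace t y)) :=
        fun i ↦ by have := hy.2 i; linarith
      obtain ⟨φ₀, l₀, hφ0, hφΦ, hnull, hnorm, hGx⟩ :=
        hKS (E4.ofTimeSpace t y) (by rw [E4.ofTimeSpace_apply_zero]; exact ht) hext'
      exact (fte_pointwise ψ hφ0 hφΦ hnull hnorm hGx).2.1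
    have hJint : ∀ s, IntegrableOn (fun y : E3 ↦ W (E4.ofTimeSpace s y) *
        KerrSchild.normalCurrent G ψ (E4.ofTimeSpace s y) 0) (closedBall (0 : E3) (t + R + 1 + 2)) :=
      fun s ↦ (hJcont.comp (E4.continuous_ofTimeSpace s)).continuousOn.integrableOn_compact
        (isCompact_closedBall _ _)
    have hgint : IntegrableOn (fun y : E3 ↦
        ∑ μ : Fin 4, (fderiv ℝ ψ (E4.ofTimeSpace t y) (E4.basisVector μ)) ^ 2) S :=
      (((hgcont t).continuousOn).integrableOn_compact (isCompact_closedBall _ _)).mono_set hSball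
    have step0 : (∫ y in closedBall (0 : E3) (t + R + 1 + 2), W (E4.ofTimeSpace 0 y) *
        KerrSchild.normalCurrent G ψ (E4.ofTimeSpace 0 y) 0) ≤ 3 * (1 + Φ) ^ 2 * (E ψ 0).toReal := by
      set X0 : Set E3 := {y : E3 | ∀ i, Kerr.rPlus (M i) (a i) <
          Kerr.radius (a i) (q i (E4.ofTimeSpace 0 y))} with hX0def
      have hX0open : IsOpen X0 := by
        rw [hX0def, Set.setOf_forall]
        exact isOpen_iInter_of_finite fun i ↦ isOpen_lt continuous_const
          ((hrcont i).comp (E4.continuous_ofTimeSpace 0))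
      set g0 : E3 → ℝ := fun y ↦
        ∑ μ : Fin 4, (fderiv ℝ ψ (E4.ofTimeSpace 0 y) (E4.basisVector μ)) ^ 2 with hg0def
      have hpt : ∀ y, W (E4.ofTimeSpace 0 y) * KerrSchild.normalCurrent G ψ (E4.ofTimeSpace 0 y) 0 ≤
          3 * (1 + Φ) ^ 2 * X0.indicator g0 y := by
        intro y
        by_cases hWy : W (E4.ofTimeSpace 0 y) = 0
        · rw [hWy, zero_mul]
          exact mul_nonneg (by positivity) (Set.indicator_nonneg (fun _ _ ↦ hgnn 0 _) _)
        · have hyK := hWK _ hWy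
          have hyX : y ∈ X0 := fun i ↦ hextK _ hyK i
          rw [Set.indicator_of_mem hyX]
          obtain ⟨φ₀, l₀, hφ0, hφΦ, hnull, hnorm, hGx⟩ :=
            hKSK _ hyK (by rw [E4.ofTimeSpace_apply_zero]) (by rw [E4.ofTimeSpace_apply_zero]; exact ht)
          have hp := fte_pointwise ψ hφ0 hφΦ hnull hnorm hGx
          calc W (E4.ofTimeSpace 0 y) * KerrSchild.normalCurrent G ψ (E4.ofTimeSpace 0 y) 0
              ≤ 1 * KerrSchild.normalCurrent G ψ (E4.ofTimeSpace 0 y) 0 :=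
                mul_le_mul_of_nonneg_right (hW01 _).2 hp.1
            _ = _ := one_mul _
            _ ≤ 3 * (1 + Φ) ^ 2 * g0 y := hp.2.2
      have hg0int : IntegrableOn g0 (closedBall (0 : E3) (t + R + 1 + 2)) :=
        (hgcont 0).continuousOn.integrableOn_compact (isCompact_closedBall _ _)
      have hind_int : IntegrableOn (X0.indicator g0) (closedBall (0 : E3) (t + R + 1 + 2)) :=
        hg0int.indicator hX0open.measurableSet
      have hfin : (∫⁻ y in X0 ∩ closedBall (0 : E3) (t + R + 1 + 2), ENNReal.ofReal (g0 y)) ≤ E ψ 0 := by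
        rw [hE]
        exact lintegral_mono_set Set.inter_subset_left
      calc (∫ y in closedBall (0 : E3) (t + R + 1 + 2), W (E4.ofTimeSpace 0 y) *
              KerrSchild.normalCurrent G ψ (E4.ofTimeSpace 0 y) 0)
          ≤ ∫ y in closedBall (0 : E3) (t + R + 1 + 2), 3 * (1 + Φ) ^ 2 * X0.indicator g0 y :=
            setIntegral_mono (hJint 0) (hind_int.const_mul _) hpt
        _ = 3 * (1 + Φ) ^ 2 * ∫ y in closedBall (0 : E3) (t + R + 1 + 2), X0.indicator g0 y :=
            integral_const_mul _ _
        _ = 3 * (1 + Φ) ^ 2 * ∫ y in X0 ∩ closedBall (0 : E3) (t + R + 1 + 2), g0 y := by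
            rw [integral_indicator hX0open.measurableSet, Measure.restrict_restrict hX0open.measurableSet]
        _ = 3 * (1 + Φ) ^ 2 *
              (∫⁻ y in X0 ∩ closedBall (0 : E3) (t + R + 1 + 2), ENNReal.ofReal (g0 y)).toReal := by
            rw [integral_eq_lintegral_of_nonneg_ae (Eventually.of_forall fun y ↦ hgnn 0 y)
              ((hgcont 0).aestronglyMeasurable)]
        _ ≤ 3 * (1 + Φ) ^ 2 * (E ψ 0).toReal :=
            mul_le_mul_of_nonneg_left (ENNReal.toReal_mono htop hfin) (by positivity)
    have hreal : ∫ y in S, (∑ μ : Fin 4, (fderiv ℝ ψ (E4.ofTimeSpace t y) (E4.basisVector μ)) ^ 2) ≤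
        18 * (1 + Φ) ^ 2 * Real.exp (192 * (1 + Φ) * D * t) * (E ψ 0).toReal := by
      have step1 : ∫ y in S, (∑ μ : Fin 4, (fderiv ℝ ψ (E4.ofTimeSpace t y) (E4.basisVector μ)) ^ 2) ≤
          ∫ y in S, 6 * (W (E4.ofTimeSpace t y) *
            KerrSchild.normalCurrent G ψ (E4.ofTimeSpace t y) 0) :=
        setIntegral_mono_on hgint (((hJint t).mono_set hSball).const_mul 6)
          hSclosed.measurableSet hcoer
      have step2 : ∫ y in S, 6 * (W (E4.ofTimeSpace t y) *
            KerrSchild.normalCurrent G ψ (E4.ofTimeSpace t y) 0) =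
          6 * ∫ y in S, W (E4.ofTimeSpace t y) *
            KerrSchild.normalCurrent G ψ (E4.ofTimeSpace t y) 0 := integral_const_mul _ _
      have step3 : (∫ y in S, W (E4.ofTimeSpace t y) *
            KerrSchild.normalCurrent G ψ (E4.ofTimeSpace t y) 0) ≤
          ∫ y in closedBall (0 : E3) (t + R + 1 + 2), W (E4.ofTimeSpace t y) *
            KerrSchild.normalCurrent G ψ (E4.ofTimeSpace t y) 0 :=
        setIntegral_mono_set (hJint t) (Eventually.of_forall (hJnn t ht le_rfl))
          (Eventually.of_forall hSball)
      have hexp0 : 0 ≤ Real.exp (192 * (1 + Φ) * D * t) := (Real.exp_pos _).le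
      have step4 : (∫ y in closedBall (0 : E3) (t + R + 1 + 2), W (E4.ofTimeSpace t y) *
            KerrSchild.normalCurrent G ψ (E4.ofTimeSpace t y) 0) ≤
          3 * (1 + Φ) ^ 2 * (E ψ 0).toReal * Real.exp (192 * (1 + Φ) * D * t) :=
        hgron.trans (mul_le_mul_of_nonneg_right step0 hexp0)
      calc _ ≤ _ := step1
        _ = _ := step2
        _ ≤ 6 * (3 * (1 + Φ) ^ 2 * (E ψ 0).toReal * Real.exp (192 * (1 + Φ) * D * t)) := by
            linarith [step3, step4]
        _ = _ := by ring
    have hlhs : ∫⁻ y in S, ENNReal.ofReal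
        (∑ μ : Fin 4, (fderiv ℝ ψ (E4.ofTimeSpace t y) (E4.basisVector μ)) ^ 2) =
        ENNReal.ofReal (∫ y in S,
          ∑ μ : Fin 4, (fderiv ℝ ψ (E4.ofTimeSpace t y) (E4.basisVector μ)) ^ 2) :=
      (ofReal_integral_eq_lintegral_ofReal hgint (Eventually.of_forall fun y ↦ hgnn t y)).symm
    rw [hlhs]
    calc ENNReal.ofReal (∫ y in S, ∑ μ : Fin 4, (fderiv ℝ ψ (E4.ofTimeSpace t y) (E4.basisVector μ)) ^ 2)
        ≤ ENNReal.ofReal (18 * (1 + Φ) ^ 2 * Real.exp (192 * (1 + Φ) * D * t) * (E ψ 0).toReal) :=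
          ENNReal.ofReal_le_ofReal hreal
      _ = ENNReal.ofReal (18 * (1 + Φ) ^ 2 * Real.exp (192 * (1 + Φ) * D * t)) *
            ENNReal.ofReal ((E ψ 0).toReal) := ENNReal.ofReal_mul (by positivity)
      _ = _ := by rw [ENNReal.ofReal_toReal htop]
  -- exhaustion of the exterior
  obtain ⟨θ₀, hθ₀, hθ₀M⟩ := fte_exists_margin hM
  obtain ⟨hmono, hUnion⟩ := fte_iUnion_truncSet
    (fun i (y : E3) ↦ Kerr.radius (a i) (q i (E4.ofTimeSpace t y))) (fun i ↦ Kerr.rPlus (M i) (a i)) hθ₀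
  have hdir := hmono.directed_le
  rw [hE, hUnion, setLIntegral_iUnion_of_directed _ hdir]
  refine iSup_le fun n ↦ ?_
  have hθn : 0 < θ₀ / ((n : ℝ) + 1) := by positivity
  have hθnM : ∀ i, θ₀ / ((n : ℝ) + 1) ≤ 6 * M i := fun i ↦
    (div_le_self hθ₀.le (by linarith [n.cast_nonneg (α := ℝ)])).trans (hθ₀M i)
  refine (key _ _ hθn hθnM (by positivity)).trans ?_
  exact mul_le_mul_of_nonneg_right (ENNReal.ofReal_le_ofReal (fte_const_le hΦ0 hD0 ht)) bot_le

end Summit.FinalStateConjecture.FinalStateConjecture.Cruxes.AdiabaticMultiKerrILED.Sketch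

end
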